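import Literature.MathematicalPhysics.QuantumLattice.HyperoctahedralFockAction
import Literature.MathematicalPhysics.QuantumLattice.SpinTwistedHubbardTorus
import HarnessLib

/-!
# Lieb's operator reflection `Θ` for Jordan–Wigner fermions: the unitary `V` with `V (c†_i P) V⋆ = c_{ρ i}`

Support file for the proof of Lieb's flux-phase theorem `Lieb1994_fluxPi_torus`
(`LiebFluxPhase.lean`; E. H. Lieb, PRL **73** (1994) 2158). Lieb's reflection of the left
operator algebra onto the right one is `Θ(A_L) = (τ R(A_L) τ⁻¹)^*` — geometric reflection `R`,
hole–particle transformation `τ`, complex conjugation — with `θ(c_l) = c†_r` [Lieb1994, p. 3]. In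
the Kronecker picture of `LiebFluxPhaseKronecker.lean` the cross hopping through the cutting plane
reads `c†_l c_r = (c†_l P) ⊗ c_r`, `c†_r c_l = (P c_l) ⊗ c†_r` (`P = (-1)^{N_L}`), so the matrix
form of `Θ` needed for the antilinear DLS inequality (`LiebFluxPhaseDLS.lean`,
`J_V(X) = V X̄ V⋆`) is a unitary `V` from the left to the right Fock space with

  `V (c†_i P) V⋆ = c_{ρ i}`,  `V (P c_i) V⋆ = c†_{ρ i}`   (`ρ` the reflection of orbitals),

all matrices involved being REAL (so `X̄ = X`). This file constructs `V = thetaMatrix ρ` and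
PROVES these identities, together with `V (c†_i c_j) V⋆ = c_{ρ i} c†_{ρ j} = δ_{ij} - c†_{ρ j} c_{ρ i}`
and `V n_i V⋆ = 1 - n_{ρ i}` — Lieb's eq. (4), `τ K(T) τ⁻¹ = K(-T^*)`, and the particle–hole
invariance of `(n - ½)`, in matrix form [Lieb1994, eq. (4) and p. 3].

* `phTwist` — the twisted hole–particle unitary `W|s⟩ = σ(s)|sᶜ⟩`,
  `σ(s) = (-1)^{C(#s,2)} ∏_{j∈s} σ_j(univ)`, with `W (c†_i P) = c_i W` (`phTwist_mul_creation_mul_parityOp`);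
* `thetaMatrix ρ = relabelMatrix ρ * phTwist` (with the tree's signed permutation matrix
  `relabelMatrix ρ` of `HyperoctahedralFockAction.lean`, `relabel ρ a = R a Rᴴ`) and the
  identities above.

## References

* [Lieb1994] E. H. Lieb, Phys. Rev. Lett. 73 (1994) 2158, p. 3 (definition of `Θ`,
  `θ(c_l) = c†_r`) and eq. (4).
* O. Bratteli, D. W. Robinson, *Operator Algebras and QSM II*, §5.2.2 (Bogoliubov
  transformations of the CAR algebra are unitarily implemented on Fock space).
-/

noncomputable section

namespace Literature.MathematicalPhysics.QuantumLattice

open Matrix Finset HubbardWave0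

/-! ### Reality of the Jordan–Wigner matrices -/

section Reality

variable {ι : Type*} [LinearOrder ι]

/-- `c_i` is a real matrix (`Xᵀ = Xᴴ`; `annihilation_transpose` of `SpinTwistedHubbardTorus`).
[folklore] -/
theorem annihilation_transpose_eq_conjTranspose (i : ι) :
    (annihilation i)ᵀ = (annihilation i)ᴴ :=
  annihilation_transpose i

/-- `c†_i` is a real matrix. [folklore] -/
theorem creation_transpose_eq_conjTranspose (i : ι) : (creation i)ᵀ = (creation i)ᴴ := by
  rw [creation_transpose, creation, conjTranspose_conjTranspose]

/-- The parity operator is a real (diagonal) matrix. [folklore] -/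
theorem parityOp_transpose_eq_conjTranspose [Fintype ι] :
    (parityOp : Matrix (Finset ι) (Finset ι) ℂ)ᵀ = parityOpᴴ := by
  rw [parityOp, diagonal_transpose, diagonal_conjTranspose]
  congr 1
  funext s
  simp

/-- Products of real matrices are real. [folklore] -/
theorem mul_transpose_eq_conjTranspose {m : Type*} [Fintype m] {A B : Matrix m m ℂ}
    (hA : Aᵀ = Aᴴ) (hB : Bᵀ = Bᴴ) : (A * B)ᵀ = (A * B)ᴴ := by
  rw [transpose_mul, conjTranspose_mul, hA, hB]

/-- A real matrix equals its entrywise conjugate `X̄ = Xᴴᵀ`. [folklore] -/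
theorem conjTranspose_transpose_of_transpose_eq_conjTranspose {m : Type*} {A : Matrix m m ℂ}
    (hA : Aᵀ = Aᴴ) : Aᴴᵀ = A := by
  rw [← hA, transpose_transpose]

/-- The parity operator is Hermitian. [folklore] -/
private theorem parityOp_conjTranspose' [Fintype ι] :
    (parityOp : Matrix (Finset ι) (Finset ι) ℂ)ᴴ = parityOp := by
  rw [parityOp, diagonal_conjTranspose]
  congr 1
  funext s
  simp

/-- `P² = 1`. [folklore] -/
private theorem parityOp_mul_parityOp' [Fintype ι] :
    (parityOp : Matrix (Finset ι) (Finset ι) ℂ) * parityOp = 1 := by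
  rw [parityOp, diagonal_mul_diagonal, ← diagonal_one]
  congr 1
  funext s
  rw [← pow_add, ← two_mul, pow_mul]
  norm_num

end Reality

/-! ### The twisted hole–particle unitary -/

section PhTwist

variable {ι : Type*} [LinearOrder ι] [Fintype ι]

/-- `σ_a(univ) · σ_a(t) = σ_a(tᶜ)`: the orbitals below `a` split between `t` and `tᶜ`. [folklore] -/
theorem jwSign_univ_mul_jwSign (a : ι) (t : Finset ι) :
    jwSign a univ * jwSign a t = jwSign a tᶜ := by
  have h : (univ.filter (· < a)).card = (t.filter (· < a)).card + (tᶜ.filter (· < a)).card := by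
    rw [← Finset.card_union_of_disjoint (Finset.disjoint_filter_filter disjoint_compl_right),
      ← Finset.filter_union, Finset.union_compl]
  rw [jwSign, jwSign, jwSign, h, pow_add]
  set A := (t.filter (· < a)).card
  set B := (tᶜ.filter (· < a)).card
  have h1 : ((-1 : ℂ) ^ A) * (-1) ^ A = 1 := by rw [← pow_add, ← two_mul, pow_mul]; norm_num
  linear_combination ((-1 : ℂ) ^ B) * h1

/-- The sign of the twisted hole–particle transformation,
`σ(s) = (-1)^{C(#s, 2)} ∏_{j ∈ s} σ_j(univ)`. [folklore] -/
def phTwistSign (s : Finset ι) : ℂ := (-1) ^ (s.card.choose 2) * ∏ j ∈ s, jwSign j (univ : Finset ι)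

/-- The sign is real. [folklore] -/
theorem star_phTwistSign (s : Finset ι) : star (phTwistSign s) = phTwistSign s := by
  unfold phTwistSign
  rw [star_mul', star_prod, star_pow, star_neg, star_one]
  congr 1
  exact Finset.prod_congr rfl fun j _ => star_jwSign j (univ : Finset ι)

/-- The sign squares to one. [folklore] -/
theorem phTwistSign_mul_self (s : Finset ι) : phTwistSign s * phTwistSign s = 1 := by
  unfold phTwistSign
  rw [mul_mul_mul_comm, ← pow_add, ← two_mul, pow_mul, neg_one_sq, one_pow, one_mul,
    ← Finset.prod_mul_distrib]
  exact Finset.prod_eq_one fun j _ => jwSign_mul_self j _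

/-- **Recursion of the sign**: `σ(s ∪ {i}) = (-1)^{#s} σ_i(univ) σ(s)` for `i ∉ s`
(`C(n+1, 2) = C(n, 2) + n`). [folklore] -/
theorem phTwistSign_insert {i : ι} {s : Finset ι} (hi : i ∉ s) :
    phTwistSign (insert i s) = (-1) ^ s.card * jwSign i univ * phTwistSign s := by
  unfold phTwistSign
  rw [Finset.card_insert_of_notMem hi, Finset.prod_insert hi, Nat.choose_succ_succ,
    Nat.choose_one_right, pow_add]
  ring

/-- The **twisted hole–particle unitary** `W|s⟩ = σ(s)|sᶜ⟩` on the Fock space `ℓ²(𝒫 ι)`: matrix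
entries `W_{t s} = [t = sᶜ] σ(s)`. It implements the CAR automorphism `c†_i P ↦ c_i`
(`phTwist_mul_creation_mul_parityOp`), i.e. Lieb's hole–particle transformation `τ` composed with
the fermion-parity twist that appears when `τ` is written in Jordan–Wigner matrices.
[cite: Lieb1994, p. 3 (hole–particle transformation `τ`)] -/
def phTwist : Matrix (Finset ι) (Finset ι) ℂ := fun t s => if t = sᶜ then phTwistSign s else 0

/-- Entries of `phTwist`. [folklore] -/
theorem phTwist_apply (t s : Finset ι) : phTwist t s = if t = sᶜ then phTwistSign s else 0 := rfl

/-- `W Wᴴ = 1`. [folklore] -/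
theorem phTwist_mul_conjTranspose : (phTwist : Matrix (Finset ι) (Finset ι) ℂ) * phTwistᴴ = 1 := by
  ext t t'
  rw [mul_apply, Finset.sum_eq_single tᶜ, one_apply]
  · rw [conjTranspose_apply, phTwist_apply, phTwist_apply, compl_compl, if_pos rfl]
    by_cases h : t = t'
    · subst h; rw [if_pos rfl, star_phTwistSign, phTwistSign_mul_self, if_pos rfl]
    · rw [if_neg (Ne.symm h), star_zero, mul_zero, if_neg h]
  · intro s _ hs
    have h : t ≠ sᶜ := fun h => hs (by rw [h, compl_compl])
    rw [phTwist_apply, if_neg h, zero_mul]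
  · exact fun h => absurd (Finset.mem_univ _) h

/-- `Wᴴ W = 1`. [folklore] -/
theorem conjTranspose_phTwist_mul_self : (phTwist : Matrix (Finset ι) (Finset ι) ℂ)ᴴ * phTwist = 1 := by
  ext s s'
  rw [mul_apply, Finset.sum_eq_single sᶜ, one_apply]
  · rw [conjTranspose_apply, phTwist_apply, phTwist_apply, if_pos rfl, star_phTwistSign]
    by_cases h : s = s'
    · subst h; rw [if_pos rfl, phTwistSign_mul_self, if_pos rfl]
    · rw [if_neg (fun h' => h (compl_injective h')), mul_zero, if_neg h]
  · intro t _ ht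
    rw [conjTranspose_apply, phTwist_apply, if_neg ht, star_zero, zero_mul]
  · exact fun h => absurd (Finset.mem_univ _) h

/-- **The intertwining identity** `W (c†_i P) = c_i W` (`P = (-1)^N`): on `|s⟩` with `i ∉ s` both
sides give `± |sᶜ ∖ {i}⟩`, and the signs agree by `phTwistSign_insert` and
`σ_i(univ) σ_i(s) = σ_i(sᶜ)`. This is `θ(c_l) = c†_r` [Lieb1994, p. 3] before the geometric
reflection, in Jordan–Wigner matrices. [cite: Lieb1994, p. 3] -/
theorem phTwist_mul_creation_mul_parityOp (i : ι) :
    phTwist * (creation i * parityOp) = annihilation i * (phTwist : Matrix (Finset ι) (Finset ι) ℂ) := by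
  -- entries of `c†_i P`
  have hcP : ∀ u s : Finset ι, (creation i * parityOp : Matrix (Finset ι) (Finset ι) ℂ) u s =
      if i ∉ s ∧ u = insert i s then jwSign i s * (-1) ^ s.card else 0 := by
    intro u s
    rw [parityOp, mul_diagonal, creation_apply, ite_mul, zero_mul]
  ext t s
  have hL : (phTwist * (creation i * parityOp) : Matrix (Finset ι) (Finset ι) ℂ) t s =
      phTwist t (insert i s) * (if i ∉ s then jwSign i s * (-1) ^ s.card else 0) := by
    rw [mul_apply, Finset.sum_eq_single (insert i s)]
    · rw [hcP]
      by_cases hi : i ∈ s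
      · rw [if_neg (fun h => h.1 hi), if_neg (fun h => h hi)]
      · rw [if_pos ⟨hi, rfl⟩, if_pos hi]
    · intro u _ hu
      rw [hcP, if_neg (fun h => hu h.2), mul_zero]
    · exact fun h => absurd (Finset.mem_univ _) h
  have hR : (annihilation i * phTwist : Matrix (Finset ι) (Finset ι) ℂ) t s =
      annihilation i t sᶜ * phTwistSign s := by
    rw [mul_apply, Finset.sum_eq_single sᶜ]
    · rw [phTwist_apply, if_pos rfl]
    · intro u _ hu
      rw [phTwist_apply, if_neg hu, mul_zero]
    · exact fun h => absurd (Finset.mem_univ _) h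
  rw [hL, hR, annihilation_apply, phTwist_apply]
  by_cases hi : i ∈ s
  · -- both sides vanish
    rw [if_neg (show ¬(i ∉ s) from fun h => h hi), mul_zero, if_neg, zero_mul]
    rintro ⟨-, h⟩
    have hmem : i ∈ insert i t := Finset.mem_insert_self i t
    rw [← h, Finset.mem_compl] at hmem
    exact hmem hi
  · rw [if_pos hi, Finset.compl_insert]
    by_cases ht : t = sᶜ.erase i
    · subst ht
      have hcond : i ∉ sᶜ.erase i ∧ sᶜ = insert i (sᶜ.erase i) :=
        ⟨Finset.notMem_erase i _, (Finset.insert_erase (Finset.mem_compl.2 hi)).symm⟩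
      rw [if_pos rfl, if_pos hcond, phTwistSign_insert hi, jwSign_erase_of_not_lt (lt_irrefl i),
        ← jwSign_univ_mul_jwSign i s]
      have h1 : ((-1 : ℂ) ^ s.card) * (-1) ^ s.card = 1 := by
        rw [← pow_add, ← two_mul, pow_mul]; norm_num
      linear_combination (jwSign i univ * phTwistSign s * jwSign i s) * h1
    · rw [if_neg ht, zero_mul, if_neg, zero_mul]
      rintro ⟨hit, h⟩
      exact ht (by rw [h, Finset.erase_insert hit])

/-- `W (c†_i P) Wᴴ = c_i`. [cite: Lieb1994, p. 3] -/
theorem phTwist_conj_creation_mul_parityOp (i : ι) :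
    phTwist * (creation i * parityOp) * phTwistᴴ = (annihilation i : Matrix (Finset ι) (Finset ι) ℂ) := by
  rw [phTwist_mul_creation_mul_parityOp, Matrix.mul_assoc, phTwist_mul_conjTranspose, Matrix.mul_one]

end PhTwist

/-! ### Lieb's `Θ` as a unitary between the left and right Fock spaces -/

section Theta

variable {ι ι' : Type*} [LinearOrder ι] [LinearOrder ι'] [Fintype ι] [Fintype ι'] (ρ : ι ≃ ι')

/-- **The matrix of Lieb's operator reflection.** For an orbital bijection `ρ : ι ≃ ι'` (the
geometric reflection of the left orbitals onto the right ones), `thetaMatrix ρ = R_ρ W` is a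
unitary `ℓ²(𝒫 ι) → ℓ²(𝒫 ι')` with `V (c†_i P) Vᴴ = c_{ρ i}` and `V (P c_i) Vᴴ = c†_{ρ i}`; the
antilinear map `X ↦ V X̄ Vᴴ` is `Θ = (τ R(·) τ⁻¹)^*` of [Lieb1994, p. 3] on the matrices of the
Kronecker picture. [cite: Lieb1994, p. 3 (definition of `Θ`)] -/
def thetaMatrix : Matrix (Finset ι') (Finset ι) ℂ :=
  relabelMatrix ρ * (phTwist : Matrix (Finset ι) (Finset ι) ℂ)

/-- `Vᴴ V = 1`. [folklore] -/
theorem conjTranspose_thetaMatrix_mul_self : (thetaMatrix ρ)ᴴ * thetaMatrix ρ = 1 := by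
  rw [thetaMatrix, conjTranspose_mul, Matrix.mul_assoc, ← Matrix.mul_assoc (relabelMatrix ρ)ᴴ,
    conjTranspose_mul_relabelMatrix, Matrix.one_mul, conjTranspose_phTwist_mul_self]

omit [Fintype ι'] in
/-- `V Vᴴ = 1`. [folklore] -/
theorem thetaMatrix_mul_conjTranspose : thetaMatrix ρ * (thetaMatrix ρ)ᴴ = 1 := by
  rw [thetaMatrix, conjTranspose_mul, Matrix.mul_assoc, ← Matrix.mul_assoc phTwist,
    phTwist_mul_conjTranspose, Matrix.one_mul, relabelMatrix_mul_conjTranspose]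

/-- Conjugation by `V` is multiplicative. [folklore] -/
theorem thetaMatrix_conj_mul (X Y : Matrix (Finset ι) (Finset ι) ℂ) :
    thetaMatrix ρ * (X * Y) * (thetaMatrix ρ)ᴴ =
      thetaMatrix ρ * X * (thetaMatrix ρ)ᴴ * (thetaMatrix ρ * Y * (thetaMatrix ρ)ᴴ) := by
  calc thetaMatrix ρ * (X * Y) * (thetaMatrix ρ)ᴴ
      = thetaMatrix ρ * (X * ((thetaMatrix ρ)ᴴ * thetaMatrix ρ) * Y) * (thetaMatrix ρ)ᴴ := by
        rw [conjTranspose_thetaMatrix_mul_self, Matrix.mul_one]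
    _ = _ := by simp only [Matrix.mul_assoc]

omit [Fintype ι'] in
/-- Conjugation by `V` is unital. [folklore] -/
theorem thetaMatrix_conj_one :
    thetaMatrix ρ * (1 : Matrix (Finset ι) (Finset ι) ℂ) * (thetaMatrix ρ)ᴴ = 1 := by
  rw [Matrix.mul_one, thetaMatrix_mul_conjTranspose]

omit [Fintype ι'] in
/-- Conjugation by `V` is a `*`-map. [folklore] -/
theorem thetaMatrix_conj_conjTranspose (X : Matrix (Finset ι) (Finset ι) ℂ) :
    thetaMatrix ρ * Xᴴ * (thetaMatrix ρ)ᴴ = (thetaMatrix ρ * X * (thetaMatrix ρ)ᴴ)ᴴ := by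
  rw [conjTranspose_mul, conjTranspose_mul, conjTranspose_conjTranspose, Matrix.mul_assoc]

/-- **`V (c†_i P) Vᴴ = c_{ρ i}`** — Lieb's `θ(c_l) = c†_r` in the Kronecker picture (where the cross
hopping is `(c†_l P) ⊗ c_r`). [cite: Lieb1994, p. 3] -/
theorem thetaMatrix_conj_creation_mul_parityOp (i : ι) :
    thetaMatrix ρ * (creation i * parityOp) * (thetaMatrix ρ)ᴴ = annihilation (ρ i) := by
  rw [thetaMatrix, conjTranspose_mul, Matrix.mul_assoc (relabelMatrix ρ) phTwist,
    Matrix.mul_assoc (relabelMatrix ρ), ← Matrix.mul_assoc (phTwist * _), phTwist_conj_creation_mul_parityOp,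
    ← Matrix.mul_assoc, relabelMatrix_mul_annihilation_mul_conjTranspose]

/-- **`V (P c_i) Vᴴ = c†_{ρ i}`** (adjoint of the previous identity). [cite: Lieb1994, p. 3] -/
theorem thetaMatrix_conj_parityOp_mul_annihilation (i : ι) :
    thetaMatrix ρ * (parityOp * annihilation i) * (thetaMatrix ρ)ᴴ = creation (ρ i) := by
  have h : (parityOp * annihilation i : Matrix (Finset ι) (Finset ι) ℂ) = (creation i * parityOp)ᴴ := by
    rw [conjTranspose_mul, parityOp_conjTranspose', creation, conjTranspose_conjTranspose]
  rw [h, thetaMatrix_conj_conjTranspose, thetaMatrix_conj_creation_mul_parityOp, creation]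

/-- **`V (c†_i c_j) Vᴴ = c_{ρ i} c†_{ρ j} = δ_{ij} - c†_{ρ j} c_{ρ i}`** — the matrix form of Lieb's
eq. (4), `τ K(T) τ⁻¹ = K(-T^*)`: under `Θ` a hopping term keeps its (conjugated) amplitude but
changes sign. [cite: Lieb1994, eq. (4)] -/
theorem thetaMatrix_conj_creation_mul_annihilation (i j : ι) :
    thetaMatrix ρ * (creation i * annihilation j) * (thetaMatrix ρ)ᴴ =
      (if i = j then 1 else 0) - creation (ρ j) * annihilation (ρ i) := by
  have h : creation i * annihilation j =
      (creation i * parityOp) * (parityOp * annihilation j : Matrix (Finset ι) (Finset ι) ℂ) := by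
    rw [Matrix.mul_assoc, ← Matrix.mul_assoc parityOp, parityOp_mul_parityOp', Matrix.one_mul]
  rw [h, thetaMatrix_conj_mul, thetaMatrix_conj_creation_mul_parityOp,
    thetaMatrix_conj_parityOp_mul_annihilation, annihilation_mul_creation]
  by_cases hij : i = j
  · subst hij; rw [if_pos rfl, if_pos rfl]
  · rw [if_neg hij, if_neg (fun h' => hij (ρ.injective h'))]

/-- **`V n_i Vᴴ = 1 - n_{ρ i}`** — particle–hole conjugation of the number operator, whence the
invariance of `(n_{x↑} - ½)(n_{x↓} - ½)` [Lieb1994, p. 2: "`W⁰` … invariant under … `τ`"].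
[cite: Lieb1994, p. 2] -/
theorem thetaMatrix_conj_numberAt (i : ι) :
    thetaMatrix ρ * numberAt i * (thetaMatrix ρ)ᴴ = 1 - numberAt (ρ i) := by
  rw [numberAt, thetaMatrix_conj_creation_mul_annihilation, if_pos rfl, numberAt]

/-- `V (n_i - ½) Vᴴ = -(n_{ρ i} - ½)`. [cite: Lieb1994, p. 2] -/
theorem thetaMatrix_conj_numberAt_sub_half (i : ι) :
    thetaMatrix ρ * (numberAt i - (1 / 2 : ℂ) • (1 : Matrix (Finset ι) (Finset ι) ℂ)) * (thetaMatrix ρ)ᴴ =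
      -(numberAt (ρ i) - (1 / 2 : ℂ) • 1) := by
  rw [Matrix.mul_sub, Matrix.sub_mul, thetaMatrix_conj_numberAt, Matrix.mul_smul, Matrix.smul_mul,
    thetaMatrix_conj_one]
  ext a b
  simp only [Matrix.sub_apply, Matrix.neg_apply, Matrix.smul_apply, smul_eq_mul]
  ring

omit [Fintype ι'] in
/-- The reflection matrix is real. [folklore] -/
theorem thetaMatrix_transpose_eq_conjTranspose : (thetaMatrix ρ)ᵀ = (thetaMatrix ρ)ᴴ := by
  ext s t'
  rw [transpose_apply, conjTranspose_apply, thetaMatrix, mul_apply, star_sum]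
  refine Finset.sum_congr rfl fun u _ => ?_
  rw [star_mul, relabelMatrix, phTwist_apply]
  split_ifs <;> simp [star_relabelSign, star_phTwistSign, mul_comm]

end Theta

end Literature.MathematicalPhysics.QuantumLattice

end
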